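import Summits.AnomalousDissipation.AnomalousDissipation.Theorems.GalerkinSteadyZerothLaw.Negative.StokesStates
import Literature.Analysis.FluidPDE.NSGalerkinStationary

/-!
# Stub `stub_coreForce` of the line `idea-sketch-ideator2` (card `euler-core-coat-readout`),
# crux stmt-AnomalousDissipation-2986 (`MirrorVariety.GalerkinSteadyZerothLaw`)

The force field of an exact-Euler core. Fix a reference level `N₀` and a real solenoidal coefficient vector
`C₀ ∈ galerkinSubspace (modes (Fin 3) N₀)` on the punctured Fourier ball; the line's force FIELD is
`f := fieldOf N₀ C₀ = realTrigPoly (modes (Fin 3) N₀) (coeffExt (modes (Fin 3) N₀) C₀)`, a real vector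
trigonometric polynomial on `T³`. We prove the four facts the composition `GalerkinSteadyZerothLaw_of` consumes:
* `f` is smooth (`isSmooth_realTrigPoly`);
* `f` is divergence free (`isDivFree_realTrigPoly` with `IsSolenoidalCoeff.isTransversal_coeffExt`);
* `f` has zero mean (`hasZeroMean_realTrigPoly_of_zero_not_mem` with `zero_not_mem_modes`), exactly as in the landed
  `steadyState_fieldOf` (`Negative/StokesStates.lean`);
* at EVERY level `N` its Fourier force vector `forceCoeff (modes (Fin 3) N) f` is the zero-extension of `C₀` read on
  `modes N`: `mFourierCoeff_realTrigPoly` (symmetric `modes N₀`, `modes_symm`; conjugate-symmetric extension,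
  `IsRealCoeff.isConjSymm_coeffExt`) gives `if k ∈ modes N₀ then coeffExt … k else 0`, and off `modes N₀` the
  extension vanishes anyway (`coeffExt_of_not_mem`).
-/

noncomputable section

-- `Summit.<Summit>.<Problem>` is the tree's mandated summit-side namespace (CONVENTIONS §2); deliberate duplicate.
set_option linter.dupNamespace false

open scoped InnerProductSpace Topology
open MeasureTheory Filter Set UnitAddTorus
open Literature.Analysis.FunctionSpaces Literature.Analysis.FunctionSpaces.Torus
open Literature.Analysis.FluidPDE Literature.Analysis.FluidPDE.Torus

namespace Summit.AnomalousDissipation.AnomalousDissipation.Theorems.GalerkinSteadyZerothLaw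

open Summit.AnomalousDissipation.AnomalousDissipation.Theorems.GalerkinSteadyZerothLaw.Negative
  (SteadyState BandLimited fieldOf steadyState_fieldOf integral_norm_sq_fieldOf loudness_fieldOf)
open Summit.AnomalousDissipation.AnomalousDissipation.Theorems.LaminarNeverLoud.Negative
  (modes forceCoeff energy dissipation modes_symm zero_not_mem_modes energy_nonneg dissipation_nonpos_of_nonpos
    isRealCoeff_forceCoeff)

/-- **stub_coreForce** (S).  The force field of a core: for `C₀` real and solenoidal at level `N₀`, the field
`f := fieldOf N₀ C₀ = realTrigPoly (modes N₀) (coeffExt C₀)` is smooth, divergence free and mean zero, and its Fourier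
force vector at EVERY level `N` is the zero-extension of `C₀` restricted to `modes N` (`mFourierCoeff_realTrigPoly`).
[folklore] -/
theorem stub_coreForce : ∀ (N₀ : ℕ) (C₀ : ↥(modes (Fin 3) N₀) → EuclideanSpace ℂ (Fin 3)),
    C₀ ∈ galerkinSubspace (modes (Fin 3) N₀) →
    IsSmooth (fieldOf N₀ C₀) ∧ IsDivFree (fieldOf N₀ C₀) ∧ HasZeroMean (fieldOf N₀ C₀) ∧
      ∀ N : ℕ, forceCoeff (modes (Fin 3) N) (fieldOf N₀ C₀) =
        fun k : ↥(modes (Fin 3) N) => coeffExt (modes (Fin 3) N₀) C₀ k := by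
  intro N₀ C₀ hC₀
  have hS : ∀ k ∈ modes (Fin 3) N₀, -k ∈ modes (Fin 3) N₀ := modes_symm N₀
  have hS0 : (0 : Fin 3 → ℤ) ∉ modes (Fin 3) N₀ := zero_not_mem_modes N₀
  have hCsymm : IsConjSymm (coeffExt (modes (Fin 3) N₀) C₀) := hC₀.1.isConjSymm_coeffExt hS
  have hCT : IsTransversal (modes (Fin 3) N₀) (coeffExt (modes (Fin 3) N₀) C₀) :=
    hC₀.2.isTransversal_coeffExt
  refine ⟨isSmooth_realTrigPoly _ _, isDivFree_realTrigPoly hCT, hasZeroMean_realTrigPoly_of_zero_not_mem hS0 _,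
    fun N => ?_⟩
  funext k
  show mFourierCoeff (EuclideanSpace.complexify ∘ realTrigPoly (modes (Fin 3) N₀) (coeffExt (modes (Fin 3) N₀) C₀))
      (k : Fin 3 → ℤ) = coeffExt (modes (Fin 3) N₀) C₀ k
  rw [mFourierCoeff_realTrigPoly hS hCsymm]
  split_ifs with hk
  · rfl
  · exact (coeffExt_of_not_mem C₀ hk).symm

end Summit.AnomalousDissipation.AnomalousDissipation.Theorems.GalerkinSteadyZerothLaw

end

-- buildfix 2026-08-20 (ops-buildfix-1 gen 7): enqueue-only re-land — rebuild after B-35 (StokesArc, p233893) healed this module's import closure; no declaration changed.
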